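import Literature.NumberTheory.Rogawski1990.ArchOrbFamGExtJumpSideAssembly             -- ★ p850629∕p850677 (LH3-p02 (g3)): `exists_std_package`, `blockWeights_of_mem_splitChartPlaces`, `isCompact_map_circleDiagonal_range`; brings ★ `ArchOrbFamGExtJumpSide`
import Literature.NumberTheory.Rogawski1990.ArchChartOrbGBlockNormal                   -- ★ p850492 (F0P3-p02 (g18)): `eM_gprimeTorus_add_smul_hcNrm_eq` (`hγ`)
import Literature.NumberTheory.Rogawski1990.ArchChartOrbGBlockNormalBinders            -- ★ p850667 (F0P3-p02 (g18)): `exists_blockNormal_binders` (`hCMν`, `hintν`)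
import Literature.NumberTheory.Automorphic.ArchInnerFormSemiregularCentralizerBlockExplicit -- ★ p850499 (LH5-p02 (g3)): (M-UNFOLD) explicit edition, clauses [4]–[10]
import Literature.MeasureTheory.Group.HaarRightInvariantOfProductDecomposition         -- ★ p850728 (F0P2-p01 (g19)): `exists_isHaarMeasure_isMulRightInvariant_isInvInvariant_centralizer_arch`
import Literature.MeasureTheory.Group.InvariantQuotientBlockDescent                    -- ★ p850497 (LH3-p03 (g4)): `exists_smul_map_mk_of_block_compact` (the `hmap` of ★ p850417)
import Literature.NumberTheory.Rogawski1990.ArchChartOrbGBlockReduction                -- ★ p850417 (F0P3-p02 (g18)) (J-G′-BLOCK): `exists_block_testFunction_chartOrbG_eventuallyEq`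
import Literature.NumberTheory.Rogawski1990.ArchDescendedFunctionSmooth                -- ★ p850672 (F0P3a-p05 (g20)) (aM-SMOOTH): `exists_contDiff_descended_eq`
import Literature.NumberTheory.Automorphic.ArchBlockEmbeddingSmooth                    -- ★ (eM-SMOOTH) (F0P3a-p05 (g20)): `exists_contDiff_coe_symm_archPiEquivCM_mulSingle_relabel_endoEmb`
import Literature.NumberTheory.Rogawski1990.ArchOrbFamGExtJumpWall                     -- ★ p850367 (LH3-p02): (c-wall) `archERhoG_mul_archRG_add_smul_hcNrm_eq`, `wallFactorLimit_ne_zero_of_hcSemireg`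
import Literature.MeasureTheory.Group.OrbitalDescentNonneg                             -- ★ p850338 (LH5-p03): `exists_continuous_hasCompactSupport_integral_comp_mul_eq_one_pos`
import Literature.Analysis.Calculus.ContDiffCompactSupportCutoff                       -- ★ p840156: `exists_contDiff_hasCompactSupport_comp_eq` (ambient cut-off to compact support)
import HarnessLib

/-!
# (B-desc): THE ALL-ORDERS DESCENT IDENTITY of the genuine `G′`-family along the normal line through a semiregular point of a noncompact wall
# — `chartOrbG(p + ν·n) = K · ∫_{U(J)} f(h · P t_z(ν) P⁻¹ · h⁻¹) dμ₀` on `0 < |ν| < δ` with `f ∈ C_c^∞(M₂(ℂ))`, `K ≠ 0`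
# (Rogawski 1990 §4.12 Lemma 4.12.1, §8.2 pp. 119–124; Harish-Chandra–van Dijk 1970 I §3; Shelstad 1979 §4)

Topic `NumberTheory/Rogawski1990`; namespace `Literature.NumberTheory.Rogawski1990`.  THEOREMS ONLY (no `def`, no instance, no notation, no axiom, no named fact, no `sorry`);
kernel lane `--kind proof --supports stmt-HodgeConjecture-24833`.  Cell `pub/hodgecm-mathlib`, crux H413 (`stmt-HodgeConjecture-24833`), F0∕P3c line LH3 (closer stub `stub_N9`,
DIRECT ROAD `F0_P3c_StubN9Direct`), LETTER L1 `HcOrbitalFamiliesStatement`, clause (I₃) `ArchHcJump` ALL ORDERS — LH3-plan (g3) RULING #14 (2026-09-02T10:03Z): the road is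
the author's «LADDER DIGEST» (★ (ELL-∞) p850639∕p850669∕p850750∕p850812∕p850822 = Harish-Chandra's rank-one ladder at one place) + THIS missing link **(B-desc)** (dealt to
LH3-p04 (g4) by name): the EXPORTED descent identity; consumers (B-norm) LH5-p03∕p04 (normal words, one real variable), (B-trans) F0P3a-p08 (g23), (I₁-faces) LH7-p04 (g4).

THE MATHEMATICS.  Fix an admissible compact chart `S` (`S ⊆ splitChartPlaces`), a covered compact place `w₀ ∉ S` (`w₀ ∈ splitChartPlaces`: the `(0,2)`-block `U(σ_{w₀}α_{τ0},
σ_{w₀}α_{τ2}) ≅ U(1,1)` is indefinite, i.e. the wall `θ₀ = θ₂` at `w₀` is NONCOMPACT), a semiregular wall point `p` (★ `HcSemireg S w₀ 0 2 p`) and `a′ ∈ C_c^∞(G′_∞)`.  The organ-J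
chain of the line is assembled EXACTLY as in ★ p850798 `orbFamGExt_jumpGSideStatement` (compact-chart half only): (M-UNFOLD) `e : Z(γ_p) ≃ₜ* B × K` (★ p850499, explicit
edition — clauses [5] torus block, [6] frozen complement, [7] `e(T′) = A × ⊤`, [8] block embedding, [10] `e|_K = id`), (B-STD) `φ : B ≃ₜ* U(J)`, `e′ = (φ × id) ∘ e`, `Ψ′`
(★ `exists_std_package`), a right- and inversion-invariant Haar `νM` on `Z(γ_p)` (★ p850728), the torus clause `hγ : e′ γ_{p+νn} = (P t_z(ν) P⁻¹, r₀)` (★ p850492, `z = e^{iθ}`,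
`θ = p w₀ 0 = p w₀ 2`, `r₀ = (e γ_p).2`), Harish-Chandra's compactness + integrability binders along the normal (★ p850667), ONE cut-off `β` of unit `Z(γ_p)`-mass (★ p850338),
the descent scalar `κ` (★ `exists_smul_map_mk_of_block_compact`: `Ψ′_*(νM∕dt′) = κ • π_* μ₀`), and ★ (J-G′-BLOCK) p850417 `exists_block_testFunction_chartOrbG_eventuallyEq`:
  **`chartOrbG L α ν′ S a′ (p + ν • hcNrm w₀ 0 2) = (dt′(B′)·κ) · ∫_{U(J)} f_B(h · P t_z(ν) P⁻¹ · h⁻¹) dμ₀`  for all small `ν ≠ 0`**,  `f_B(u) = (a′)_M^β(e′⁻¹(u, r₀))`.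
NEW here: `f_B` IS THE RESTRICTION OF A SMOOTH AMBIENT FUNCTION — `(a′)_M^β = ΘM ∘ ↑↑↑` with `ΘM ∈ C^∞(M₃(L ⊗ ℝ))` (★ (aM-SMOOTH) p850672), `↑↑↑(e⁻¹(b, 1)) = Λ(↑↑b)` with `Λ` smooth
(★ (eM-SMOOTH) over clause [8]), `e⁻¹(b, r₀) = e⁻¹(b,1)·r₀` ([10]), `φ⁻¹(u) = M₀⁻¹ u M₀` (★ `exists_std_package` value formula), so `f_B(u) = ΘM(Λ(M₀⁻¹ ↑↑u M₀) · ↑↑↑r₀) =: f(↑↑u)`,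
`f ∈ C^∞(M₂(ℂ))`; `f_B` has compact support on `U(J)`, and the ambient `f` is cut off to compact support without changing `f ∘ ↑↑` (Tietze-free: `U(J)` is closed, ★ p840156
pattern).  §3 multiplies by `archERhoG·archRG = (2 sin ν)·R(ν)` (★ (c-wall) p850367; `R` smooth, `R(0) ≠ 0` at a semiregular point — (B-desc-R), LH1-p03 (g5), binder form here)
and reads `orbFamGExt = orbFamG = archRG · chartOrbG` off the wall (★ `eventually_add_smul_hcNrm_mem_regG`):
  **`archERhoG S (p + ν n) · orbFamGExt L α ν′ a′ S (p + ν n) = m(ν) · ((2 sin ν) · ∫_{U(J)} f(↑↑(h · P t_z(ν) P⁻¹ · h⁻¹)) dμ₀)`**, `m = K·R` smooth, `m(0) ≠ 0` —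
the right factor is EXACTLY the functional of ★ (ELL-∞) in the Cayley frame of `U(J)` (★ (α2)∕p09 FILE 4b dock it to the diagonal frame `a = (2,−2)` by `f ∘ Ad_P`, `μ₀ ∘ Ad_P`).
PAIR GENERALITY: the wall `(w₀, 0, 2)` at a covered compact place — the organ-J∕D4b currency; other noncompact pairs are (B-trans)'s relabelling.  The PRODUCT-NEIGHBOURHOOD edition
(RULING #15: `c` free near `p`, `f` depending smoothly on the tangential coordinates) is the sequel (same ★ descent at `s := γ_p`, clause [6] for `r(c)`).
HONEST LABEL: HC_CM is proved only modulo the 7 printed citations (2 remaining: hLiu418 = `stmt-HodgeConjecture-24832`, h413 = `stmt-HodgeConjecture-24833`) until rung 0 closes;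
count-neutral assembly of ★ bricks + the smooth reading; letter L1 stays a `sorry` of record until all its clauses are paid.

## References
* [Rogawski1990] J. D. Rogawski, *Automorphic Representations of Unitary Groups in Three Variables*, Ann. of Math. Stud. 123 (1990), §4.12 Lemma 4.12.1 p. 66 (descent to `M`,
  ONE `φ` near `1`), §8.2 pp. 119–124 (`g(ψ) = 2 sin ψ · Φ`, the `U(1,1)`-block at a compact wall).
* [HarishChandra1970] Harish-Chandra (notes by G. van Dijk), *Harmonic Analysis on Reductive p-adic Groups*, LNM 162 (1970), Part I §3 Lemmas 22–23.
* [Shelstad1979] D. Shelstad, *Characters and inner forms of a quasi-split group over ℝ*, Compositio Math. 39 (1979), §4 pp. 22–25, Lemma 4.3.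
* [Varadarajan1977] V. S. Varadarajan, *Harmonic Analysis on Real Reductive Groups*, LNM 576 (1977), Part I §1.12.
-/

set_option autoImplicit false

noncomputable section

open MeasureTheory MeasureTheory.Measure NumberField NumberField.InfinitePlace NumberField.mixedEmbedding Matrix Complex Set Filter Topology
open scoped MatrixGroups Matrix Real Classical ENNReal NNReal ContDiff Matrix.Norms.Operator
open Literature.NumberTheory.Automorphic Literature.NumberTheory.Automorphic.UnitaryGroup Literature.NumberTheory.Automorphic.ArchCartan
open Literature.NumberTheory.GaloisRepresentations Literature.MeasureTheory.Group

namespace Literature.NumberTheory.Rogawski1990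

/-! ## §1 The descent identity for the chart functional `chartOrbG` along the wall normal, with a SMOOTH ambient block test function -/

section Chart

variable (L : Type) [Field L] [NumberField L] [IsCMField L] (α : Fin 3 → L)
  [MeasurableSpace ↥(arch (↥(maximalRealSubfield L)) L (IsCMField.complexConj L) 3 (Matrix.diagonal α))]
  [BorelSpace ↥(arch (↥(maximalRealSubfield L)) L (IsCMField.complexConj L) 3 (Matrix.diagonal α))]
  (ν' : Measure ↥(arch (↥(maximalRealSubfield L)) L (IsCMField.complexConj L) 3 (Matrix.diagonal α))) [ν'.IsHaarMeasure] [ν'.IsMulRightInvariant]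

set_option maxHeartbeats 1600000 in
/-- **(B-desc) — THE DESCENT IDENTITY FOR `chartOrbG` ALONG THE WALL NORMAL, SMOOTH GRADE.**  For the house frame (`α_i ≠ 0`, real embeddings), an admissible compact chart `S`,
a covered compact place `w₀ ∉ S`, a semiregular point `p` of the wall `(w₀, 0, 2)` and `a′ ∈ C_c^∞(G′_∞)`, and for every Haar `μ₀` on the standard block `U(J)`: there are `K ≠ 0`
and a SMOOTH ambient `f : M₂(ℂ) → ℂ` with compact support whose restriction to `U(J)` is the block test function of ★ (J-G′-BLOCK), such that for all small `ν ≠ 0`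
**`chartOrbG L α ν′ S a′ (p + ν • hcNrm w₀ 0 2) = K · ∫_{U(J)} f(↑↑(h · P t_z(ν) P⁻¹ · h⁻¹)) dμ₀(h)`**, `z = e^{i p_{w₀,0}}`, `P = (1 1; 1 −1)` — ★ p850353∕(ELL-∞)-Cayley's torus
element token for token. [cite: Rogawski1990, §4.12 Lemma 4.12.1 p. 66; §8.2 pp. 119–124] [cite: HarishChandra1970, Part I §3 Lemma 22] [cite: Shelstad1979, §4 Lemma 4.3 (p. 25)] -/
theorem exists_descent_normalLine_chartOrbG (hα : ∀ i, α i ≠ 0)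
    (hreal : ∀ (w : {w : InfinitePlace L // IsComplex w}) (i : Fin 3), (w.1.embedding (α i)).im = 0)
    {J : Matrix (Fin 2) (Fin 2) ℂ} (hJ : J = (StdForm.antidiagonal 2).over ℂ)
    [MeasurableSpace ↥(unitaryGroupOfForm (starRingEnd ℂ) J)] [BorelSpace ↥(unitaryGroupOfForm (starRingEnd ℂ) J)]
    [LocallyCompactSpace ↥(unitaryGroupOfForm (starRingEnd ℂ) J)] [SecondCountableTopology ↥(unitaryGroupOfForm (starRingEnd ℂ) J)]
    (μ₀ : Measure ↥(unitaryGroupOfForm (starRingEnd ℂ) J)) [μ₀.IsHaarMeasure] [μ₀.IsMulRightInvariant]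
    {S : Finset {w : InfinitePlace L // IsComplex w}} {w₀ : {w : InfinitePlace L // IsComplex w}} {p : {w : InfinitePlace L // IsComplex w} → Fin 3 → ℝ}
    (hS : ∀ w, w ∈ S → w ∈ splitChartPlaces L α) (hw₀ : w₀ ∉ S) (hwsp : w₀ ∈ splitChartPlaces L α) (hp : HcSemireg S w₀ 0 2 p)
    {a' : ↥(arch (↥(maximalRealSubfield L)) L (IsCMField.complexConj L) 3 (Matrix.diagonal α)) → ℂ} (ha' : ArchSmooth L 3 (Matrix.diagonal α) a') :
    ∃ (K : ℂ) (f : Matrix (Fin 2) (Fin 2) ℂ → ℂ), K ≠ 0 ∧ ContDiff ℝ ∞ f ∧ HasCompactSupport f ∧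
      ∀ᶠ ν in 𝓝[≠] (0 : ℝ), chartOrbG L α ν' S a' (p + ν • hcNrm w₀ 0 2) =
        K * ∫ h : ↥(unitaryGroupOfForm (starRingEnd ℂ) J),
          f (((h * ⟨Matrix.GeneralLinearGroup.mkOfDetNeZero !![(1 : ℂ), 1; 1, -1] det_cayleyTwo_ne_zero *
                circleDiagonal 2 ![Circle.exp (p w₀ 0) * Circle.exp ν, Circle.exp (p w₀ 0) * Circle.exp (-ν)] *
                (Matrix.GeneralLinearGroup.mkOfDetNeZero !![(1 : ℂ), 1; 1, -1] det_cayleyTwo_ne_zero)⁻¹,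
              cayley_conj_circleDiagonal_mem_of_eq_over hJ _⟩ * h⁻¹ : ↥(unitaryGroupOfForm (starRingEnd ℂ) J)) : GL (Fin 2) ℂ) : Matrix (Fin 2) (Fin 2) ℂ) ∂μ₀ := by
  -- ### frame facts
  have ha'c : Continuous a' := ha'.continuous
  have ha's : HasCompactSupport a' := ha'.hasCompactSupport
  obtain ⟨hreal2, hsgn⟩ := blockWeights_of_mem_splitChartPlaces L α w₀ hwsp
  have hs02 : p w₀ 0 = p w₀ 2 := hp.1
  have h02c : Circle.exp (p w₀ 0) = Circle.exp (p w₀ 2) := by rw [hs02]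
  have h01 : Circle.exp (p w₀ 0) ≠ Circle.exp (p w₀ 1) := by
    intro h; have h2 := hp.2.1; rw [hcThird_zero_two] at h2; exact h2 h.symm
  have hreg : ∀ w, w ≠ w₀ → w ∉ S → Function.Injective fun i : Fin 3 => Circle.exp (p w i) := fun w hne hw => hp.2.2.1 w hw hne
  have hregS : ∀ w, w ∈ S → p w 0 ≠ 0 := hp.2.2.2
  -- ### (M-UNFOLD), explicit edition (★ p850499): `e : Z(γ_p) ≃ₜ* B × K` with clauses [4]–[10]
  refine (exists_continuousMulEquiv_centralizer_gprimeTorus_semireg_explicit L α S w₀ hα hS hw₀ p h02c h01 hreg hregS).elim fun K hK => hK.elim fun e he => ?_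
  obtain ⟨hKc, hKsub, hKcomm, h4, h5, h6, hmapT, h8, h9, h10⟩ := he
  -- ### (B-STD) package: `φ`, `e′`, `Ψ` (★ `exists_std_package`)
  refine (exists_std_package L α w₀ hJ hreal2 hsgn e _ _ hmapT).elim fun φ hφ => hφ.elim fun e' hY => hY.elim fun Ψ hZ => ?_
  have hφ := hZ.1
  have hval := hZ.2.1
  have he' := hZ.2.2.1
  have hmapT' := hZ.2.2.2.1
  have hmem := hZ.2.2.2.2.1
  have hΨ := hZ.2.2.2.2.2.2
  -- ### the chart torus sits inside `Z(γ_p)`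
  have hT : chartTorusG L α S ≤ Subgroup.centralizer ({gprimeTorus L α S p} : Set ↥(arch (↥(maximalRealSubfield L)) L (IsCMField.complexConj L) 3 (Matrix.diagonal α))) :=
    chartTorusG_le_centralizer L α S p
  -- ### instances on `Z(γ_p)`, its quotient, `K`, `U(J) ⧸ φ(A)`
  have hZc : IsClosed ((Subgroup.centralizer ({gprimeTorus L α S p} : Set ↥(arch (↥(maximalRealSubfield L)) L (IsCMField.complexConj L) 3 (Matrix.diagonal α)))) :
      Set ↥(arch (↥(maximalRealSubfield L)) L (IsCMField.complexConj L) 3 (Matrix.diagonal α))) := isClosed_centralizer_singleton_of_t2 _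
  haveI : LocallyCompactSpace ↥(Subgroup.centralizer ({gprimeTorus L α S p} : Set ↥(arch (↥(maximalRealSubfield L)) L (IsCMField.complexConj L) 3 (Matrix.diagonal α)))) := hZc.isClosedEmbedding_subtypeVal.locallyCompactSpace
  haveI : SecondCountableTopology ↥(Subgroup.centralizer ({gprimeTorus L α S p} : Set ↥(arch (↥(maximalRealSubfield L)) L (IsCMField.complexConj L) 3 (Matrix.diagonal α)))) := TopologicalSpace.Subtype.secondCountableTopology _
  letI : MeasurableSpace (↥(Subgroup.centralizer ({gprimeTorus L α S p} : Set ↥(arch (↥(maximalRealSubfield L)) L (IsCMField.complexConj L) 3 (Matrix.diagonal α)))) ⧸ (chartTorusG L α S).subgroupOf (Subgroup.centralizer ({gprimeTorus L α S p} : Set ↥(arch (↥(maximalRealSubfield L)) L (IsCMField.complexConj L) 3 (Matrix.diagonal α))))) := borel _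
  haveI : BorelSpace (↥(Subgroup.centralizer ({gprimeTorus L α S p} : Set ↥(arch (↥(maximalRealSubfield L)) L (IsCMField.complexConj L) 3 (Matrix.diagonal α)))) ⧸ (chartTorusG L α S).subgroupOf (Subgroup.centralizer ({gprimeTorus L α S p} : Set ↥(arch (↥(maximalRealSubfield L)) L (IsCMField.complexConj L) 3 (Matrix.diagonal α))))) := ⟨rfl⟩
  haveI : LocallyCompactSpace ↥K := hKc.isClosedEmbedding_subtypeVal.locallyCompactSpace
  haveI : SecondCountableTopology ↥K := TopologicalSpace.Subtype.secondCountableTopology _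
  letI : MeasurableSpace ↥K := borel _
  haveI : BorelSpace ↥K := ⟨rfl⟩
  letI : MeasurableSpace (↥(unitaryGroupOfForm (starRingEnd ℂ) J) ⧸ Subgroup.map (φ : ↥(unitaryGroupOfForm (starRingEnd ℂ) ((Matrix.diagonal ![α (lineOf (formSign L α w₀) 0), α (lineOf (formSign L α w₀) 2)]).map w₀.1.embedding)) →* ↥(unitaryGroupOfForm (starRingEnd ℂ) J)) ((circleDiagonal 2).codRestrict (unitaryGroupOfForm (starRingEnd ℂ) ((Matrix.diagonal ![α (lineOf (formSign L α w₀) 0), α (lineOf (formSign L α w₀) 2)]).map w₀.1.embedding)) (circleDiagonal_mem_archLocal_diagonal L 2 ![α (lineOf (formSign L α w₀) 0), α (lineOf (formSign L α w₀) 2)] w₀)).range) := borel _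
  haveI : BorelSpace (↥(unitaryGroupOfForm (starRingEnd ℂ) J) ⧸ Subgroup.map (φ : ↥(unitaryGroupOfForm (starRingEnd ℂ) ((Matrix.diagonal ![α (lineOf (formSign L α w₀) 0), α (lineOf (formSign L α w₀) 2)]).map w₀.1.embedding)) →* ↥(unitaryGroupOfForm (starRingEnd ℂ) J)) ((circleDiagonal 2).codRestrict (unitaryGroupOfForm (starRingEnd ℂ) ((Matrix.diagonal ![α (lineOf (formSign L α w₀) 0), α (lineOf (formSign L α w₀) 2)]).map w₀.1.embedding)) (circleDiagonal_mem_archLocal_diagonal L 2 ![α (lineOf (formSign L α w₀) 0), α (lineOf (formSign L α w₀) 2)] w₀)).range) := ⟨rfl⟩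
  haveI : CompactSpace ↥(Subgroup.map (φ : ↥(unitaryGroupOfForm (starRingEnd ℂ) ((Matrix.diagonal ![α (lineOf (formSign L α w₀) 0), α (lineOf (formSign L α w₀) 2)]).map w₀.1.embedding)) →* ↥(unitaryGroupOfForm (starRingEnd ℂ) J)) ((circleDiagonal 2).codRestrict (unitaryGroupOfForm (starRingEnd ℂ) ((Matrix.diagonal ![α (lineOf (formSign L α w₀) 0), α (lineOf (formSign L α w₀) 2)]).map w₀.1.embedding)) (circleDiagonal_mem_archLocal_diagonal L 2 ![α (lineOf (formSign L α w₀) 0), α (lineOf (formSign L α w₀) 2)] w₀)).range) := isCompact_iff_compactSpace.mp (isCompact_map_circleDiagonal_range L α w₀ φ)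
  have hAcomm : ∀ a b : ↥(Subgroup.map (φ : ↥(unitaryGroupOfForm (starRingEnd ℂ) ((Matrix.diagonal ![α (lineOf (formSign L α w₀) 0), α (lineOf (formSign L α w₀) 2)]).map w₀.1.embedding)) →* ↥(unitaryGroupOfForm (starRingEnd ℂ) J)) ((circleDiagonal 2).codRestrict (unitaryGroupOfForm (starRingEnd ℂ) ((Matrix.diagonal ![α (lineOf (formSign L α w₀) 0), α (lineOf (formSign L α w₀) 2)]).map w₀.1.embedding)) (circleDiagonal_mem_archLocal_diagonal L 2 ![α (lineOf (formSign L α w₀) 0), α (lineOf (formSign L α w₀) 2)] w₀)).range), a * b = b * a := by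
    rintro ⟨_, ⟨x, ⟨u, rfl⟩, rfl⟩⟩ ⟨_, ⟨y, ⟨v, rfl⟩, rfl⟩⟩
    apply Subtype.ext
    show (φ : ↥(unitaryGroupOfForm (starRingEnd ℂ) ((Matrix.diagonal ![α (lineOf (formSign L α w₀) 0), α (lineOf (formSign L α w₀) 2)]).map w₀.1.embedding)) →* ↥(unitaryGroupOfForm (starRingEnd ℂ) J)) _ * (φ : ↥(unitaryGroupOfForm (starRingEnd ℂ) ((Matrix.diagonal ![α (lineOf (formSign L α w₀) 0), α (lineOf (formSign L α w₀) 2)]).map w₀.1.embedding)) →* ↥(unitaryGroupOfForm (starRingEnd ℂ) J)) _ =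
      (φ : ↥(unitaryGroupOfForm (starRingEnd ℂ) ((Matrix.diagonal ![α (lineOf (formSign L α w₀) 0), α (lineOf (formSign L α w₀) 2)]).map w₀.1.embedding)) →* ↥(unitaryGroupOfForm (starRingEnd ℂ) J)) _ * (φ : ↥(unitaryGroupOfForm (starRingEnd ℂ) ((Matrix.diagonal ![α (lineOf (formSign L α w₀) 0), α (lineOf (formSign L α w₀) 2)]).map w₀.1.embedding)) →* ↥(unitaryGroupOfForm (starRingEnd ℂ) J)) _
    rw [← map_mul, ← map_mul, ← map_mul, ← map_mul, mul_comm u v]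
  -- ### a right- and inversion-invariant Haar measure on `Z(γ_p)` (★ p850728)
  obtain ⟨νM, hνM1, hνM2, hνM3⟩ := exists_isHaarMeasure_isMulRightInvariant_isInvInvariant_centralizer_arch (↥(maximalRealSubfield L)) L (IsCMField.complexConj L) 3
    (Matrix.diagonal α) ({gprimeTorus L α S p} : Set ↥(arch (↥(maximalRealSubfield L)) L (IsCMField.complexConj L) 3 (Matrix.diagonal α))) K hKc hKcomm e' μ₀
  haveI := hνM1; haveI := hνM2; haveI := hνM3
  -- ### the torus clause `hγ` along the normal (★ p850492)
  have hγ := eM_gprimeTorus_add_smul_hcNrm_eq L α S w₀ p K e h5 h6 hJ φ (fun u _ => hφ u) e' he' hs02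
  -- ### Harish-Chandra's binders along the normal (★ p850667) and ONE cut-off `β` (★ p850338)
  obtain ⟨CS, hCSc, hCMν, hintν⟩ := exists_blockNormal_binders L α S w₀ p ν' hα hreal hS hw₀ hp ha'c ha's
  obtain ⟨β, hβc, hβs, hβ0, -, hβ1⟩ := exists_continuous_hasCompactSupport_integral_comp_mul_eq_one_pos
    (Subgroup.centralizer ({gprimeTorus L α S p} : Set ↥(arch (↥(maximalRealSubfield L)) L (IsCMField.complexConj L) 3 (Matrix.diagonal α)))) hZc νM (hCSc.insert 1)
  have hβ1S : ∀ x ∈ CS, ∀ k₀ : ↥(Subgroup.centralizer ({gprimeTorus L α S p} : Set ↥(arch (↥(maximalRealSubfield L)) L (IsCMField.complexConj L) 3 (Matrix.diagonal α)))), ∫ h : ↥(Subgroup.centralizer ({gprimeTorus L α S p} : Set ↥(arch (↥(maximalRealSubfield L)) L (IsCMField.complexConj L) 3 (Matrix.diagonal α)))), β (x * (k₀ : ↥(arch (↥(maximalRealSubfield L)) L (IsCMField.complexConj L) 3 (Matrix.diagonal α))) *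
      (h : ↥(arch (↥(maximalRealSubfield L)) L (IsCMField.complexConj L) 3 (Matrix.diagonal α)))) ∂νM = 1 :=
    fun x hx k₀ => hβ1 x (Set.mem_insert_of_mem _ hx) k₀
  -- ### the descent scalar `κ`: `Ψ_*(νM ∕ dt′) = κ • π_* μ₀` (★ `exists_smul_map_mk_of_block_compact`)
  haveI := isHaarMeasure_chartHaarG L α S
  haveI := isInvInvariant_chartHaarG L α S
  haveI := isHaarMeasure_map_subgroupOfEquivOfLe_symm hT (chartHaarG L α S)
  haveI := isInvInvariant_map_subgroupOfEquivOfLe_symm hT (chartHaarG L α S)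
  have hTc := isClosed_subgroupOf_of_isClosed _ (Subgroup.centralizer ({gprimeTorus L α S p} : Set ↥(arch (↥(maximalRealSubfield L)) L (IsCMField.complexConj L) 3 (Matrix.diagonal α))))
    (isClosed_chartTorusG L α S)
  have hAcpt : IsCompact ((Subgroup.map (φ : ↥(unitaryGroupOfForm (starRingEnd ℂ) ((Matrix.diagonal ![α (lineOf (formSign L α w₀) 0), α (lineOf (formSign L α w₀) 2)]).map w₀.1.embedding)) →* ↥(unitaryGroupOfForm (starRingEnd ℂ) J)) ((circleDiagonal 2).codRestrict (unitaryGroupOfForm (starRingEnd ℂ) ((Matrix.diagonal ![α (lineOf (formSign L α w₀) 0), α (lineOf (formSign L α w₀) 2)]).map w₀.1.embedding)) (circleDiagonal_mem_archLocal_diagonal L 2 ![α (lineOf (formSign L α w₀) 0), α (lineOf (formSign L α w₀) 2)] w₀)).range) :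
      Set ↥(unitaryGroupOfForm (starRingEnd ℂ) J)) := isCompact_iff_compactSpace.mpr inferInstance
  have hA : IsClosed ((Subgroup.map (φ : ↥(unitaryGroupOfForm (starRingEnd ℂ) ((Matrix.diagonal ![α (lineOf (formSign L α w₀) 0), α (lineOf (formSign L α w₀) 2)]).map w₀.1.embedding)) →* ↥(unitaryGroupOfForm (starRingEnd ℂ) J)) ((circleDiagonal 2).codRestrict (unitaryGroupOfForm (starRingEnd ℂ) ((Matrix.diagonal ![α (lineOf (formSign L α w₀) 0), α (lineOf (formSign L α w₀) 2)]).map w₀.1.embedding)) (circleDiagonal_mem_archLocal_diagonal L 2 ![α (lineOf (formSign L α w₀) 0), α (lineOf (formSign L α w₀) 2)] w₀)).range) :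
      Set ↥(unitaryGroupOfForm (starRingEnd ℂ) J)) := hAcpt.isClosed
  letI : CommGroup ↥K := { (inferInstance : Group ↥K) with mul_comm := fun a b => Subtype.ext (hKcomm _ a.2 _ b.2) }
  let νK : Measure ↥K := haarMeasure (Classical.arbitrary (TopologicalSpace.PositiveCompacts ↥K))
  haveI : νK.IsInvInvariant := IsHaarMeasure.isInvInvariant_of_regular νK
  haveI : νK.IsMulRightInvariant := isMulRightInvariant_of_isInvInvariant νK
  letI : CommGroup ↥(Subgroup.map (φ : ↥(unitaryGroupOfForm (starRingEnd ℂ) ((Matrix.diagonal ![α (lineOf (formSign L α w₀) 0), α (lineOf (formSign L α w₀) 2)]).map w₀.1.embedding)) →* ↥(unitaryGroupOfForm (starRingEnd ℂ) J)) ((circleDiagonal 2).codRestrict (unitaryGroupOfForm (starRingEnd ℂ) ((Matrix.diagonal ![α (lineOf (formSign L α w₀) 0), α (lineOf (formSign L α w₀) 2)]).map w₀.1.embedding)) (circleDiagonal_mem_archLocal_diagonal L 2 ![α (lineOf (formSign L α w₀) 0), α (lineOf (formSign L α w₀) 2)] w₀)).range) :=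
    { (inferInstance : Group _) with mul_comm := hAcomm }
  let ρA : Measure ↥(Subgroup.map (φ : ↥(unitaryGroupOfForm (starRingEnd ℂ) ((Matrix.diagonal ![α (lineOf (formSign L α w₀) 0), α (lineOf (formSign L α w₀) 2)]).map w₀.1.embedding)) →* ↥(unitaryGroupOfForm (starRingEnd ℂ) J)) ((circleDiagonal 2).codRestrict (unitaryGroupOfForm (starRingEnd ℂ) ((Matrix.diagonal ![α (lineOf (formSign L α w₀) 0), α (lineOf (formSign L α w₀) 2)]).map w₀.1.embedding)) (circleDiagonal_mem_archLocal_diagonal L 2 ![α (lineOf (formSign L α w₀) 0), α (lineOf (formSign L α w₀) 2)] w₀)).range) :=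
    haarMeasure (Classical.arbitrary (TopologicalSpace.PositiveCompacts _))
  haveI : ρA.IsInvInvariant := IsHaarMeasure.isInvInvariant_of_regular ρA
  obtain ⟨κ, hκ, hmap, -⟩ := exists_smul_map_mk_of_block_compact e' ((chartTorusG L α S).subgroupOf _) hTc _ hA hmem Ψ hΨ
    (Measure.map (Subgroup.subgroupOfEquivOfLe hT).symm (chartHaarG L α S)) νM ρA μ₀ νK
  -- ### (J-G′-BLOCK): the block test function `f_B ∈ C_c(U(J))` and the identity (★ p850417)
  refine (exists_block_testFunction_chartOrbG_eventuallyEq L α ν' a' S w₀ p (gprimeTorus L α S p) hT (Subgroup.map (φ : ↥(unitaryGroupOfForm (starRingEnd ℂ) ((Matrix.diagonal ![α (lineOf (formSign L α w₀) 0), α (lineOf (formSign L α w₀) 2)]).map w₀.1.embedding)) →* ↥(unitaryGroupOfForm (starRingEnd ℂ) J)) ((circleDiagonal 2).codRestrict (unitaryGroupOfForm (starRingEnd ℂ) ((Matrix.diagonal ![α (lineOf (formSign L α w₀) 0), α (lineOf (formSign L α w₀) 2)]).map w₀.1.embedding)) (circleDiagonal_mem_archLocal_diagonal L 2 ![α (lineOf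 (formSign L α w₀) 0), α (lineOf (formSign L α w₀) 2)] w₀)).range) e' Ψ hΨ μ₀
    (fun ν : ℝ => (⟨Matrix.GeneralLinearGroup.mkOfDetNeZero !![(1 : ℂ), 1; 1, -1] det_cayleyTwo_ne_zero *
        circleDiagonal 2 ![Circle.exp (p w₀ 0) * Circle.exp ν, Circle.exp (p w₀ 0) * Circle.exp (-ν)] *
        (Matrix.GeneralLinearGroup.mkOfDetNeZero !![(1 : ℂ), 1; 1, -1] det_cayleyTwo_ne_zero)⁻¹, cayley_conj_circleDiagonal_mem_of_eq_over hJ _⟩ : ↥(unitaryGroupOfForm (starRingEnd ℂ) J)))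
    (e ⟨gprimeTorus L α S p, gprimeTorus_mem_centralizer L α S p p⟩).2 hγ νM ha'c ha's hβc hβs hβ0 hβ1S hCMν hintν hmap).elim
    fun fB hfB => ?_
  obtain ⟨hfBc, hfBs, hfBdef, hdesc⟩ := hfB
  -- ### the descent constant `K = dt′(B′)·κ ≠ 0`
  have hdtS := toReal_chartHaarG_chartBoxImgG_pos L α S hα hS
  have hK0 : (((chartHaarG L α S (chartBoxImgG L α S)).toReal : ℂ) * ((κ : ℝ) : ℂ)) ≠ 0 :=
    mul_ne_zero (Complex.ofReal_ne_zero.2 hdtS.ne') (Complex.ofReal_ne_zero.2 (NNReal.coe_ne_zero.2 hκ))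
  -- ### THE SMOOTH AMBIENT READING of `f_B(u) = (a′)_M^β (e′⁻¹(u, r₀))`
  -- (aM-SMOOTH): `(a′)_M^β = ΘM ∘ ↑↑↑` on `Z(γ_p)`
  obtain ⟨ΘM, hΘM, haM⟩ := exists_contDiff_descended_eq L 3 (Matrix.diagonal α) ν' ha' β hβc hβs
    (Subgroup.centralizer ({gprimeTorus L α S p} : Set ↥(arch (↥(maximalRealSubfield L)) L (IsCMField.complexConj L) 3 (Matrix.diagonal α))))
  -- (eM-SMOOTH) over clause [8]: `↑↑↑(e⁻¹(b, 1)) = Λ(↑↑b)`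
  obtain ⟨Λ, hΛ, hΛb⟩ := exists_contDiff_coe_symm_archPiEquivCM_mulSingle_relabel_endoEmb L α w₀ (lineOf (formSign L α w₀))
  have hΛb' : ∀ b : ↥(unitaryGroupOfForm (starRingEnd ℂ) ((Matrix.diagonal ![α (lineOf (formSign L α w₀) 0), α (lineOf (formSign L α w₀) 2)]).map w₀.1.embedding)),
      ((((e.symm (b, 1) : ↥(Subgroup.centralizer ({gprimeTorus L α S p} : Set ↥(arch (↥(maximalRealSubfield L)) L (IsCMField.complexConj L) 3 (Matrix.diagonal α))))) :
          ↥(arch (↥(maximalRealSubfield L)) L (IsCMField.complexConj L) 3 (Matrix.diagonal α))) : GL (Fin 3) (mixedSpace L)) : Matrix (Fin 3) (Fin 3) (mixedSpace L)) =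
        Λ ((b : GL (Fin 2) ℂ) : Matrix (Fin 2) (Fin 2) ℂ) := fun b => by
    rw [h8 b]; exact hΛb b
  -- the frame matrix of `φ`: `↑(φ h) = M₀ · ↑h · M₀⁻¹`, hence `↑↑(φ⁻¹ u) = ↑(M₀⁻¹) · ↑↑u · ↑M₀`
  obtain ⟨M₀, hM₀⟩ : ∃ M₀ : GL (Fin 2) ℂ, ∀ h : ↥(unitaryGroupOfForm (starRingEnd ℂ) ((Matrix.diagonal ![α (lineOf (formSign L α w₀) 0), α (lineOf (formSign L α w₀) 2)]).map w₀.1.embedding)),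
      ((φ h : ↥(unitaryGroupOfForm (starRingEnd ℂ) J)) : GL (Fin 2) ℂ) = M₀ * (h : GL (Fin 2) ℂ) * M₀⁻¹ :=
    ⟨_, fun h => by rw [hval h, _root_.mul_inv_rev]⟩
  have hφsymm : ∀ u : ↥(unitaryGroupOfForm (starRingEnd ℂ) J),
      (((φ.symm u : ↥(unitaryGroupOfForm (starRingEnd ℂ) ((Matrix.diagonal ![α (lineOf (formSign L α w₀) 0), α (lineOf (formSign L α w₀) 2)]).map w₀.1.embedding))) : GL (Fin 2) ℂ) : Matrix (Fin 2) (Fin 2) ℂ) =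
        ((M₀⁻¹ : GL (Fin 2) ℂ) : Matrix (Fin 2) (Fin 2) ℂ) * ((u : GL (Fin 2) ℂ) : Matrix (Fin 2) (Fin 2) ℂ) * ((M₀ : GL (Fin 2) ℂ) : Matrix (Fin 2) (Fin 2) ℂ) := fun u => by
    have h := hM₀ (φ.symm u)
    rw [ContinuousMulEquiv.apply_symm_apply] at h
    have h' : ((φ.symm u : ↥(unitaryGroupOfForm (starRingEnd ℂ) ((Matrix.diagonal ![α (lineOf (formSign L α w₀) 0), α (lineOf (formSign L α w₀) 2)]).map w₀.1.embedding))) : GL (Fin 2) ℂ) =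
        M₀⁻¹ * (u : GL (Fin 2) ℂ) * M₀ := by
      rw [h]; group
    rw [h', Units.val_mul, Units.val_mul]
  -- `e′⁻¹(u, r₀) = e⁻¹(φ⁻¹ u, 1) · r₀` (clause [10]: `e` is the identity on `K`)
  have hsymm : ∀ u : ↥(unitaryGroupOfForm (starRingEnd ℂ) J),
      e'.symm (u, (e ⟨gprimeTorus L α S p, gprimeTorus_mem_centralizer L α S p p⟩).2) =
        e.symm (φ.symm u, 1) * ((e ⟨gprimeTorus L α S p, gprimeTorus_mem_centralizer L α S p p⟩).2 : ↥(Subgroup.centralizer ({gprimeTorus L α S p} : Set ↥(arch (↥(maximalRealSubfield L)) L (IsCMField.complexConj L) 3 (Matrix.diagonal α))))) := fun u => by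
    apply e'.injective
    rw [ContinuousMulEquiv.apply_symm_apply, map_mul, he', he', ContinuousMulEquiv.apply_symm_apply, ContinuousMulEquiv.apply_symm_apply,
      h10 _ ((e ⟨gprimeTorus L α S p, gprimeTorus_mem_centralizer L α S p p⟩).2).2]
    ext <;> simp
  -- the ambient function
  obtain ⟨f₀, hf₀⟩ : ∃ f₀ : Matrix (Fin 2) (Fin 2) ℂ → ℂ, f₀ = fun X => ΘM (Λ (((M₀⁻¹ : GL (Fin 2) ℂ) : Matrix (Fin 2) (Fin 2) ℂ) * X * ((M₀ : GL (Fin 2) ℂ) : Matrix (Fin 2) (Fin 2) ℂ)) *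
      (((((e ⟨gprimeTorus L α S p, gprimeTorus_mem_centralizer L α S p p⟩).2 : ↥(Subgroup.centralizer ({gprimeTorus L α S p} : Set ↥(arch (↥(maximalRealSubfield L)) L (IsCMField.complexConj L) 3 (Matrix.diagonal α))))) :
          ↥(arch (↥(maximalRealSubfield L)) L (IsCMField.complexConj L) 3 (Matrix.diagonal α))) : GL (Fin 3) (mixedSpace L)) : Matrix (Fin 3) (Fin 3) (mixedSpace L))) := ⟨_, rfl⟩
  have hf₀s : ContDiff ℝ ∞ f₀ := by
    rw [hf₀]
    exact hΘM.comp ((hΛ.comp ((contDiff_const.mul contDiff_id).mul contDiff_const)).mul contDiff_const)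
  have hf₀B : ∀ u : ↥(unitaryGroupOfForm (starRingEnd ℂ) J), fB u = f₀ ((u : GL (Fin 2) ℂ) : Matrix (Fin 2) (Fin 2) ℂ) := fun u => by
    have haM' := congrFun haM (e'.symm (u, (e ⟨gprimeTorus L α S p, gprimeTorus_mem_centralizer L α S p p⟩).2))
    rw [hfBdef, hf₀]
    dsimp only at haM' ⊢
    rw [haM', hsymm u, Subgroup.coe_mul, Subgroup.coe_mul, Units.val_mul, hΛb' (φ.symm u), hφsymm u]
  -- cut off to ambient compact support without changing `f₀ ∘ ↑↑` (★ p840156)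
  have hcoeJ : Continuous fun u : ↥(unitaryGroupOfForm (starRingEnd ℂ) J) => ((u : GL (Fin 2) ℂ) : Matrix (Fin 2) (Fin 2) ℂ) :=
    Units.continuous_val.comp continuous_subtype_val
  have hf₀c : HasCompactSupport (f₀ ∘ fun u : ↥(unitaryGroupOfForm (starRingEnd ℂ) J) => ((u : GL (Fin 2) ℂ) : Matrix (Fin 2) (Fin 2) ℂ)) := by
    have h : (f₀ ∘ fun u : ↥(unitaryGroupOfForm (starRingEnd ℂ) J) => ((u : GL (Fin 2) ℂ) : Matrix (Fin 2) (Fin 2) ℂ)) = fB := funext fun u => (hf₀B u).symm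
    rw [h]; exact hfBs
  obtain ⟨f, hf, hfc, -, hff₀⟩ := Literature.Analysis.Calculus.exists_contDiff_hasCompactSupport_comp_eq hcoeJ hf₀s hf₀c
  refine ⟨(((chartHaarG L α S (chartBoxImgG L α S)).toReal : ℂ) * ((κ : ℝ) : ℂ)), f, hK0, hf, hfc, ?_⟩
  filter_upwards [hdesc] with ν hν
  rw [hν]
  congr 1
  refine integral_congr_ae (Filter.Eventually.of_forall fun b => ?_)
  beta_reduce
  rw [hf₀B, hff₀]

/-- **(B-desc) — THE DESCENT IDENTITY FOR THE TWISTED EXTENDED FAMILY `e^ρ·orbFamGExt` ALONG THE WALL NORMAL.**  Same setting; with the explicit wall factor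
`R(ν) = i·e^{iν}(1 − e^{i(φ−θ−ν)})(1 − e^{i(θ−ν−φ)})·∏_{w′ ≠ w₀}(frozen factors at p)` of ★ (c-wall) `archERhoG_mul_archRG_add_smul_hcNrm_eq` (`e^ρ·R′ = (2 sin ν)·R(ν)`; `R → r ≠ 0`
by ★ `tendsto_wallFactorR_nhds_zero`∕`wallFactorLimit_ne_zero_of_hcSemireg`; `R` is `C^∞` — (B-desc-R), LH1-p03 (g5)): for all small `ν ≠ 0`
**`archERhoG S (p + ν n) · orbFamGExt L α ν′ a′ S (p + ν n) = (K · R(ν)) · ((2 sin ν) · ∫_{U(J)} f(↑↑(h · P t_z(ν) P⁻¹ · h⁻¹)) dμ₀)`** — the right factor is EXACTLY the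
normalised elliptic orbital integral of ★ (ELL-∞) in the Cayley frame of `U(J)` (`orbFamGExt = orbFamG = R′·chartOrbG` off the wall, ★ `eventually_add_smul_hcNrm_mem_regG`).
[cite: Rogawski1990, §8.2 pp. 119–124; §4.12 Lemma 4.12.1 p. 66] [cite: Shelstad1979, §4 Lemma 4.3 (p. 25); Prop. 4.5 (p. 26)] [cite: Varadarajan1977, Part I §1.12] -/
theorem exists_descent_normalLine_orbFamGExt (hα : ∀ i, α i ≠ 0)
    (hreal : ∀ (w : {w : InfinitePlace L // IsComplex w}) (i : Fin 3), (w.1.embedding (α i)).im = 0)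
    {J : Matrix (Fin 2) (Fin 2) ℂ} (hJ : J = (StdForm.antidiagonal 2).over ℂ)
    [MeasurableSpace ↥(unitaryGroupOfForm (starRingEnd ℂ) J)] [BorelSpace ↥(unitaryGroupOfForm (starRingEnd ℂ) J)]
    [LocallyCompactSpace ↥(unitaryGroupOfForm (starRingEnd ℂ) J)] [SecondCountableTopology ↥(unitaryGroupOfForm (starRingEnd ℂ) J)]
    (μ₀ : Measure ↥(unitaryGroupOfForm (starRingEnd ℂ) J)) [μ₀.IsHaarMeasure] [μ₀.IsMulRightInvariant]
    {S : Finset {w : InfinitePlace L // IsComplex w}} {w₀ : {w : InfinitePlace L // IsComplex w}} {p : {w : InfinitePlace L // IsComplex w} → Fin 3 → ℝ}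
    (hS : ∀ w, w ∈ S → w ∈ splitChartPlaces L α) (hw₀ : w₀ ∉ S) (hwsp : w₀ ∈ splitChartPlaces L α) (hp : HcSemireg S w₀ 0 2 p)
    {a' : ↥(arch (↥(maximalRealSubfield L)) L (IsCMField.complexConj L) 3 (Matrix.diagonal α)) → ℂ} (ha' : ArchSmooth L 3 (Matrix.diagonal α) a') :
    ∃ (K : ℂ) (f : Matrix (Fin 2) (Fin 2) ℂ → ℂ), K ≠ 0 ∧ ContDiff ℝ ∞ f ∧ HasCompactSupport f ∧
      ∀ᶠ ν in 𝓝[≠] (0 : ℝ), archERhoG S (p + ν • hcNrm w₀ 0 2) * orbFamGExt L α ν' a' S (p + ν • hcNrm w₀ 0 2) =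
        (K * (I * ((Circle.exp ν : ℂ) * ((1 - (Circle.exp (p w₀ 1 - p w₀ 0 - ν) : ℂ)) * (1 - (Circle.exp (p w₀ 0 - ν - p w₀ 1) : ℂ)))) *
          ∏ w' ∈ Finset.univ.erase w₀,
            ((if w' ∈ S then (1 : ℂ) else (Circle.exp (p w' 0 - p w' 2) : ℂ)) *
              (if w' ∈ S then
                  ((|Real.exp (p w' 0) - Real.exp (-p w' 0)| *
                    ‖Complex.exp (p w' 0 + p w' 2 * I) - Complex.exp (p w' 1 * I)‖ * ‖Complex.exp (-p w' 0 + p w' 2 * I) - Complex.exp (p w' 1 * I)‖ : ℝ) : ℂ)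
                else (1 - (Circle.exp (p w' 1 - p w' 0) : ℂ)) * (1 - (Circle.exp (p w' 2 - p w' 0) : ℂ)) * (1 - (Circle.exp (p w' 2 - p w' 1) : ℂ)))))) *
        ((2 * Real.sin ν : ℂ) * ∫ h : ↥(unitaryGroupOfForm (starRingEnd ℂ) J),
          f (((h * ⟨Matrix.GeneralLinearGroup.mkOfDetNeZero !![(1 : ℂ), 1; 1, -1] det_cayleyTwo_ne_zero *
                circleDiagonal 2 ![Circle.exp (p w₀ 0) * Circle.exp ν, Circle.exp (p w₀ 0) * Circle.exp (-ν)] *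
                (Matrix.GeneralLinearGroup.mkOfDetNeZero !![(1 : ℂ), 1; 1, -1] det_cayleyTwo_ne_zero)⁻¹,
              cayley_conj_circleDiagonal_mem_of_eq_over hJ _⟩ * h⁻¹ : ↥(unitaryGroupOfForm (starRingEnd ℂ) J)) : GL (Fin 2) ℂ) : Matrix (Fin 2) (Fin 2) ℂ) ∂μ₀) := by
  obtain ⟨K, f, hK, hf, hfc, hdesc⟩ := exists_descent_normalLine_chartOrbG L α ν' hα hreal hJ μ₀ hS hw₀ hwsp hp ha'
  refine ⟨K, f, hK, hf, hfc, ?_⟩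
  filter_upwards [hdesc, eventually_add_smul_hcNrm_mem_regG hw₀ (show (0 : Fin 3) ≠ 2 by decide) hp] with ν hν hreg
  rw [orbFamGExt_of_mem_regG_of_admissible L α ν' a' S hS hreg, ← mul_assoc, archERhoG_mul_archRG_add_smul_hcNrm_eq S hw₀ hp.1 ν, hν]
  ring

end Chart

end Literature.NumberTheory.Rogawski1990

end
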